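import Summits.QuantumFields.BalabanUV.T4Continuum.Support.ShellMeasureExpJacobianSUN
import Literature.MathematicalPhysics.QuantumFieldTheory.Balaban1983to89.T4HaarSU2ExpChart

/-!
# `T4Continuum.ShellMeasureExpHaarSU2Chart` — THE DICTIONARY BETWEEN THE QUATERNION EXPONENTIAL CHART OF `SU(2)` AND
# THE `SU(N)` ENGINE's CHART AT `N = 2`: `ℝ³ ≃ E_2`, `dimSU 2 = 3`, the two chart points agree, `expJacSU = sinc²(‖v‖/√2)`
(cell `pub-balaban`, sub-cell `t4`, spine estimate NE7c (node U5b); NE7c formalisation swarm, crew seat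
`b2b-balaban-t4-ne7c-formalise-leaf-09` gen 5; row S3 «SM-L9 SU(N) chart» of `t4/b2b-balaban-t4-ne7c-p1/LEAVES-NE7c-P1.md`
(trigger `t4/T4-NE7c-TRIGGER.json`, c5: optional and last) — file 1/2 of «(CH)₁ at the certified instance `N = 2`»;
imports S3 file 4 `ShellMeasureExpJacobianSUN` (p209077) and the tree's `T4HaarSU2ExpChart` ONLY; ADDITIVE, modifies
nothing; 0 `def … : Prop`, 0 sorry, 0 citations)

HONEST FRAMING.  Finite four-torus programme, rung (B)+1 only — NOT infinite volume, NOT a mass gap, NOT the Clay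
problem, NOT summit progress; (B), `BetaPertHyp`, (B^μ) not consumed.  NE7c (`T4IndicatorShell.ShellWeightBound`) is
NOT PRINTED and NOT PROVED; «NE7c ⇐ the named binders».  Nothing printed in [Balaban 1983–89] is read or asserted here:
this file is linear algebra of `𝔰𝔲(2)` and the closed form of the tree's `SU(N)` Jacobian at `N = 2`; every declaration
is [folklore].

WHY THIS FILE.  Row S3's `SU(N)` engine (`ShellMeasureRealizedSUN.slotAntiConcentration_realized_suN_expJac`) has ONE
located binder beyond the `SU(2)` road, the one-bond chart identity (CH)₁ (GAPS G-ne7cL04-1), typed with the tree's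
ARBITRARY orthonormal Hilbert–Schmidt coordinates `coordSU : E_N ≃ₗᵢ 𝔰𝔲(N)`, the chart point `expPtSU v = exp (coordSU v)`
and the discriminant-quotient Jacobian `expJacSU`.  At `N = 2` the tree HOLDS the Haar formula in QUATERNION coordinates
(`T4HaarSU2ExpChart`: `x ∈ ℝ³ ↦ expPoint x = exp(x₀i + x₁j + x₂k)`, density `(2π²)⁻¹ sinc²‖x‖`).  This file is the
dictionary between the two typings (file 2/2 `ShellMeasureExpHaarSU2` transports the measure identity along it):
* §1 `suGen : ℝ³ →ₗ 𝔰𝔲(2)`, `x ↦ quatMatrix (ι x)` (the tree's `QuantumLattice.quatMatrix` on the pure quaternion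
  `ι x = imQuat x`): INTO `𝔰𝔲(2)` (`quatMatrix_imQuat_mem`), ONTO (`exists_quatMatrix_imQuat_eq`), `‖suGen x‖_HS = √2‖x‖`
  (`norm_suGen`, Frobenius scope = the pinned norm of `lieSU`); hence `suGenEquiv : ℝ³ ≃ₗ 𝔰𝔲(2)`, **`dimSU_two :
  dimSU 2 = 3`**, the coordinate change **`chartE3 = coordSU⁻¹ ∘ suGen : ℝ³ ≃ₗ E_2`** (`norm_chartE3 : ‖chartE3 x‖ = √2‖x‖`,
  `genSU_chartE3 : genSU (chartE3 x) = quatMatrix (ι x)`), and **`expPtSU_chartE3 : expPtSU (chartE3 x) = expPoint x`**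
  (`quatMatrix` intertwines the exponentials, `T4QuatExpLog.quatMatrix_exp`).
* §2 **`expJacSU_two`**: for `v ≠ 0` in `E_2`, `expJacSU v = sinc²(‖v‖/√2)` — the Hermitian generator of a trace-free
  skew-Hermitian `2 × 2` matrix of HS-norm `‖v‖` has eigenvalues `±‖v‖/√2` (`norm_sq_eq_sum_sq`, trace `0`), one root
  pair, and `expJacSU_eq_prod_sinc` has the single factor `sinc²((θ₁−θ₀)/2)`.  (At `v = 0` the determinant formula gives
  `0` — a Lebesgue-null exception, immaterial for a density.)

WHAT THIS DOES NOT DO.  No measure identity (file 2); (CH)₁ for `N ≥ 3`; nothing of Bałaban's; nothing in the countdown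
moves (spine PROVED 0/9).  HONEST DEPENDENCY (cell): continuum YM on T⁴ ⇐ BetaPertH ∧ nine spine estimates (0/9
proved); BetaPertH ⇐ (D1) ∧ (D4) ∧ CAP+tail; G-an2-4 gates asym, D1 and NE2/3/4.
-/

noncomputable section

namespace Summit.QuantumFields.BalabanUV.T4Continuum.ShellMeasureExpHaarSU2Chart

open MeasureTheory Set Function Metric NormedSpace
open scoped ENNReal Quaternion
open Literature.MathematicalPhysics.QuantumFieldTheory.Balaban1983to89
open Literature.MathematicalPhysics.QuantumLattice (quatMatrix quatToSU2 coe_quatToSU2_of_norm_eq_one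
  star_quatMatrix_mul_self quatMatrix_smul quatMatrix_neg)
open Literature.Geometry.GaugeTheory (quatMatrix_add quatMatrix_zero quatMatrix_star quatMatrixLinear
  quatMatrixLinear_apply)
open T4AdjointCovarianceUnitary (lieSU mem_lieSU_iff expSU coe_expSU)
open T4HaarSU2ExpChart (imQuat imQuat_apply imQuat_re imQuat_imI imQuat_imJ imQuat_imK norm_imQuat expPoint
  norm_exp_imQuat)
open T4QuatExpLog (quatMatrix_exp)
open ShellMeasureExpChartSUN ShellMeasureVandermondeSUN ShellMeasureExpJacobianSUN

/-- `ℝ³` with its Euclidean structure (the quaternion chart space of `T4HaarSU2ExpChart`). [folklore] -/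
abbrev E3 : Type := EuclideanSpace ℝ (Fin 3)

/-- a pure-imaginary quaternion is anti-self-adjoint: `star (ι x) = −ι x`. [folklore] -/
theorem star_imQuat (x : E3) : star (imQuat x) = -imQuat x := by
  ext <;> simp [imQuat_apply]

/-- the quaternion matrix of `ι x` is trace-free skew-Hermitian: `quatMatrix (ι x) ∈ 𝔰𝔲(2)`. [folklore] -/
theorem quatMatrix_imQuat_mem (x : E3) : quatMatrix (imQuat x) ∈ lieSU (Fin 2) := by
  rw [mem_lieSU_iff]
  refine ⟨?_, ?_⟩
  · rw [Matrix.star_eq_conjTranspose, ← quatMatrix_star, star_imQuat, quatMatrix_neg]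
  · rw [Matrix.trace_fin_two]
    apply Complex.ext <;> simp [quatMatrix, imQuat_apply]

/-- THE GENERATOR MAP `x ↦ quatMatrix (ι x)` as a real-linear map `ℝ³ → 𝔰𝔲(2)`. [folklore] -/
def suGen : E3 →ₗ[ℝ] lieSU (Fin 2) :=
  LinearMap.codRestrict (lieSU (Fin 2)) (quatMatrixLinear.comp imQuat) fun x => quatMatrix_imQuat_mem x

/-- `suGen x = quatMatrix (ι x)` on matrices. [folklore] -/
@[simp] theorem coe_suGen (x : E3) : ((suGen x : lieSU (Fin 2)) : Matrix (Fin 2) (Fin 2) ℂ) = quatMatrix (imQuat x) :=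
  rfl

/-- every trace-free skew-Hermitian `2 × 2` matrix is the quaternion matrix of a pure-imaginary quaternion. [folklore] -/
theorem exists_quatMatrix_imQuat_eq {M : Matrix (Fin 2) (Fin 2) ℂ} (hM1 : star M = -M) (hM2 : M.trace = 0) :
    ∃ x : E3, quatMatrix (imQuat x) = M := by
  have h00 : star (M 0 0) = -M 0 0 := by
    have := congr_fun (congr_fun hM1 0) 0
    simpa [Matrix.star_apply] using this
  have h10 : star (M 0 1) = -M 1 0 := by
    have := congr_fun (congr_fun hM1 1) 0
    simpa [Matrix.star_apply] using this
  have htr : M 0 0 + M 1 1 = 0 := by rw [← Matrix.trace_fin_two]; exact hM2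
  have hre : (M 0 0).re = 0 := by
    have := congrArg Complex.re h00
    simp at this; linarith
  refine ⟨WithLp.toLp 2 ![(M 0 0).im, (M 0 1).re, (M 0 1).im], ?_⟩
  ext i j
  fin_cases i <;> fin_cases j
  · apply Complex.ext <;> simp [quatMatrix, imQuat_apply, hre]
  · apply Complex.ext <;> simp [quatMatrix, imQuat_apply]
  · have h : M 1 0 = -star (M 0 1) := by rw [h10, neg_neg]
    show quatMatrix _ 1 0 = M 1 0
    rw [h]
    apply Complex.ext <;> simp [quatMatrix, imQuat_apply]
  · have h : M 1 1 = -M 0 0 := by linear_combination htr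
    show quatMatrix _ 1 1 = M 1 1
    rw [h]
    apply Complex.ext <;> simp [quatMatrix, imQuat_apply, hre]

/-- `suGen` is ONTO `𝔰𝔲(2)`. [folklore] -/
theorem suGen_surjective : Function.Surjective suGen := fun X => by
  obtain ⟨hX1, hX2⟩ := mem_lieSU_iff.mp X.2
  obtain ⟨x, hx⟩ := exists_quatMatrix_imQuat_eq hX1 hX2
  exact ⟨x, Subtype.ext hx⟩

/-- **THE HILBERT–SCHMIDT NORM OF THE GENERATOR**: `‖quatMatrix (ι x)‖_HS = √2 · ‖x‖` (the `2 × 2` matrix of a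
pure-imaginary quaternion `q` has `Mᴴ M = |q|² · 1`, trace `2|q|²`). [folklore] -/
theorem norm_suGen (x : E3) : ‖suGen x‖ = Real.sqrt 2 * ‖x‖ := by
  have hsq : ‖suGen x‖ ^ 2 = 2 * ‖x‖ ^ 2 := by
    open scoped Matrix.Norms.Frobenius in
    have h1 : ‖suGen x‖ = ‖quatMatrix (imQuat x)‖ := by rw [← coe_suGen, Submodule.coe_norm]
    rw [h1, Matrix.frobenius_norm_sq_eq_re_trace, ← Matrix.star_eq_conjTranspose, star_quatMatrix_mul_self,
      Matrix.trace_smul, Matrix.trace_one, Fintype.card_fin, RCLike.re_to_complex, ← norm_imQuat x,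
      Quaternion.normSq_eq_norm_mul_self, smul_eq_mul, Complex.re_ofReal_mul]
    simp [sq]
    ring
  have h0 : 0 ≤ ‖suGen x‖ := norm_nonneg _
  have h2 : Real.sqrt 2 * ‖x‖ = Real.sqrt (2 * ‖x‖ ^ 2) := by
    rw [Real.sqrt_mul' _ (sq_nonneg _), Real.sqrt_sq (norm_nonneg _)]
  rw [h2, ← hsq, Real.sqrt_sq h0]

/-- `suGen` is injective (it scales norms by `√2`). [folklore] -/
theorem suGen_injective : Function.Injective suGen := by
  intro x y h
  have h1 : suGen (x - y) = 0 := by rw [map_sub, h, sub_self]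
  have h2 : ‖x - y‖ = 0 := by
    have := norm_suGen (x - y)
    rw [h1, norm_zero] at this
    have hs : (0 : ℝ) < Real.sqrt 2 := Real.sqrt_pos.mpr two_pos
    nlinarith [norm_nonneg (x - y)]
  exact sub_eq_zero.mp (norm_eq_zero.mp h2)

/-- `ℝ³ ≃ 𝔰𝔲(2)` as real vector spaces, via `x ↦ quatMatrix (ι x)`. [folklore] -/
def suGenEquiv : E3 ≃ₗ[ℝ] lieSU (Fin 2) :=
  LinearEquiv.ofBijective suGen ⟨suGen_injective, suGen_surjective⟩

/-- `suGenEquiv` is `suGen`. [folklore] -/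
@[simp] theorem suGenEquiv_apply (x : E3) : suGenEquiv x = suGen x := rfl

/-- **`dim_ℝ 𝔰𝔲(2) = 3`**: the chart dimension `d_2` of `ShellMeasureExpChartSUN` is `3`. [folklore] -/
theorem dimSU_two : dimSU 2 = 3 := by
  unfold dimSU
  rw [← suGenEquiv.finrank_eq, finrank_euclideanSpace_fin]

/-- THE COORDINATE CHANGE `ℝ³ ≃ E_2` (quaternion coordinates → the tree's orthonormal `𝔰𝔲(2)`-coordinates):
`x ↦ coordSU⁻¹ (quatMatrix (ι x))`, a real-linear equivalence. [folklore] -/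
def chartE3 : E3 ≃ₗ[ℝ] ChartSU 2 := suGenEquiv.trans (coordSU (N := 2)).symm.toLinearEquiv

/-- `coordSU (chartE3 x) = quatMatrix (ι x)` in `𝔰𝔲(2)`. [folklore] -/
theorem coordSU_chartE3 (x : E3) : coordSU (chartE3 x) = suGen x := by
  show coordSU ((coordSU (N := 2)).symm (suGenEquiv x)) = suGen x
  rw [LinearIsometryEquiv.apply_symm_apply, suGenEquiv_apply]

/-- `genSU (chartE3 x) = quatMatrix (ι x)`: the tree's chart generator at the transported point IS the quaternion
matrix. [folklore] -/
theorem genSU_chartE3 (x : E3) : genSU (chartE3 x) = quatMatrix (imQuat x) := by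
  unfold genSU
  rw [coordSU_chartE3, coe_suGen]

/-- `‖chartE3 x‖ = √2 · ‖x‖`. [folklore] -/
theorem norm_chartE3 (x : E3) : ‖chartE3 x‖ = Real.sqrt 2 * ‖x‖ := by
  rw [← norm_genSU, coordSU_chartE3, norm_suGen]

/-- `‖chartE3⁻¹ v‖ = ‖v‖ / √2`. [folklore] -/
theorem norm_chartE3_symm (v : ChartSU 2) : ‖chartE3.symm v‖ = ‖v‖ / Real.sqrt 2 := by
  have h := norm_chartE3 (chartE3.symm v)
  rw [LinearEquiv.apply_symm_apply] at h
  have hs : (0 : ℝ) < Real.sqrt 2 := Real.sqrt_pos.mpr two_pos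
  field_simp
  linarith

/-- **THE TWO EXPONENTIAL CHARTS AGREE**: `expPtSU (chartE3 x) = expPoint x` — the tree's `SU(N)` chart point at
`N = 2`, read at the transported coordinates, IS the quaternion chart point `exp(ι x)` of `T4HaarSU2ExpChart`
(`quatMatrix` intertwines the exponentials, `T4QuatExpLog.quatMatrix_exp`). [folklore] -/
theorem expPtSU_chartE3 (x : E3) : expPtSU (chartE3 x) = expPoint x := by
  apply Subtype.ext
  rw [coe_expPtSU, genSU_chartE3]
  show _ = ((quatToSU2 (exp (imQuat x)) : SUN 2) : Matrix (Fin 2) (Fin 2) ℂ)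
  rw [coe_quatToSU2_of_norm_eq_one (norm_exp_imQuat x), quatMatrix_exp]

/-- … as functions: `expPoint = expPtSU ∘ chartE3`. [folklore] -/
theorem expPoint_eq_comp : expPoint = expPtSU ∘ (chartE3 : E3 → ChartSU 2) :=
  funext fun x => (expPtSU_chartE3 x).symm

/-! ## §2 The exponential Haar Jacobian of `SU(2)`: `expJacSU v = sinc²(‖v‖/√2)` off the origin -/

/-- `Ioi 0 = {1}` in `Fin 2`. [folklore] -/
theorem Ioi_zero_fin_two : Finset.Ioi (0 : Fin 2) = {1} := by decide

/-- `Ioi 1 = ∅` in `Fin 2`. [folklore] -/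
theorem Ioi_one_fin_two : Finset.Ioi (1 : Fin 2) = ∅ := by decide

/-- **THE `SU(2)` JACOBIAN IN CLOSED FORM.**  For `v ≠ 0` in the chart space `E_2` (Hilbert–Schmidt coordinates of
`𝔰𝔲(2)`): `expJacSU v = sinc²(‖v‖/√2)` — the Hermitian generator has eigenvalues `±‖v‖/√2` (trace `0`,
`‖v‖² = θ₀² + θ₁²`), the only root difference is `θ₁ − θ₀ = ∓√2‖v‖`, and the root-space formula
`ShellMeasureExpJacobianSUN.expJacSU_eq_prod_sinc` has the single factor `sinc²((θ₁−θ₀)/2)`.  (At `v = 0` the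
determinant formula gives `0`, immaterial for a density.) [folklore] -/
theorem expJacSU_two {v : ChartSU 2} (hv : v ≠ 0) : expJacSU v = Real.sinc (‖v‖ / Real.sqrt 2) ^ 2 := by
  obtain ⟨U, θ, h⟩ := exists_conjDiag v
  have htr : θ 0 + θ 1 = 0 := by
    have h1 : Matrix.trace (herm v) = 0 := by
      unfold herm
      rw [Matrix.trace_smul, trace_genSU, smul_zero]
    rw [h, trace_conjDiag, Fin.sum_univ_two] at h1
    exact_mod_cast h1
  have hθ1 : θ 1 = -θ 0 := by linarith
  have hn : ‖v‖ ^ 2 = 2 * θ 0 ^ 2 := by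
    rw [norm_sq_eq_sum_sq h, Fin.sum_univ_two, hθ1]
    ring
  have hθ0 : θ 0 ≠ 0 := by
    intro h0
    apply hv
    have h2 : ‖v‖ ^ 2 = 0 := by rw [hn, h0]; ring
    exact norm_eq_zero.mp (pow_eq_zero_iff two_ne_zero |>.mp h2)
  have hreg : ∏ i : Fin 2, ∏ j ∈ Finset.Ioi i, (θ j - θ i) ≠ 0 := by
    rw [Fin.prod_univ_two, Ioi_zero_fin_two, Ioi_one_fin_two, Finset.prod_singleton, Finset.prod_empty, mul_one,
      hθ1]
    intro h2
    apply hθ0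
    linarith
  have hnv : ‖v‖ / Real.sqrt 2 = |θ 0| := by
    have hs : (0 : ℝ) < Real.sqrt 2 := Real.sqrt_pos.mpr two_pos
    have h3 : ‖v‖ = Real.sqrt 2 * |θ 0| := by
      have h4 : ‖v‖ = Real.sqrt (2 * θ 0 ^ 2) := by rw [← hn, Real.sqrt_sq (norm_nonneg _)]
      rw [h4, Real.sqrt_mul' _ (sq_nonneg _), Real.sqrt_sq_eq_abs]
    rw [h3]
    field_simp
  rw [expJacSU_eq_prod_sinc h hreg, Fin.prod_univ_two, Ioi_zero_fin_two, Ioi_one_fin_two, Finset.prod_singleton,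
    Finset.prod_empty, mul_one, hθ1, hnv]
  have h5 : (-θ 0 - θ 0) / 2 = -θ 0 := by ring
  rw [h5, Real.sinc_neg, sinc_abs]

end Summit.QuantumFields.BalabanUV.T4Continuum.ShellMeasureExpHaarSU2Chart

end
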